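import Summits.Ventures.HodgeKum4.Theses.KummerFixedLocus
import Summits.Ventures.HodgeKum4.Theorems.LaneVDefs
import Summits.Ventures.HodgeKum4.Theorems.KummerFixedLocusKummerDivisorClassLefschetz
import Summits.Ventures.HodgeKum4.Theorems.KummerFixedLocusKummerRangeEqInvariants
import Summits.Ventures.HodgeKum4.Theorems.KummerFixedLocusHilbertKummerTransfer
import Literature.AlgebraicGeometry.HilbertScheme.LefschetzDualHilbertScheme
import Literature.AlgebraicGeometry.HilbertScheme.LefschetzDualTransfer
import Literature.AlgebraicGeometry.HilbertScheme.HilbertSchemeOfPointsExists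
import Literature.AlgebraicGeometry.HilbertScheme.PoincareCasimirElement
import Literature.AlgebraicGeometry.Hyperkaehler.GeneralizedKummerHilbertSchemePullback
import Literature.AlgebraicGeometry.Hyperkaehler.GeneralizedKummerTypeCohomologyTransport
import Literature.AlgebraicGeometry.Hyperkaehler.LLVStructureKummerType
import Literature.AlgebraicGeometry.Hyperkaehler.IrreducibleSymplecticOfDeformationType
import Literature.AlgebraicGeometry.Hyperkaehler.IrreducibleSymplecticOddCohomology
import Literature.AlgebraicGeometry.HodgeTheory.PolarizationClassExists
import Literature.AlgebraicGeometry.HodgeTheory.DualLefschetzInLefschetzInvolutionAlgebraHolds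
import Literature.AlgebraicGeometry.HodgeTheory.ComplexConjugationHolds
import Literature.AlgebraicGeometry.Motives.AbelianVarietyProjectiveChart
import Literature.AlgebraicGeometry.Surfaces.K3LatticeInvariantsProofs
import Summits.Ventures.HodgeKum4.Theorems.KummerFixedLocusLefschetzGenerationHilb5
import HarnessLib

/-!
# L1 `LefschetzGenerationKum4` PROVED MODULO PRINT (p1 g5): the lane-(V) chain with L1-Hilb(5) discharged

Cell `hodge-kum4`, crux stmt-Ventures-19134 (`…Theses.KummerFixedLocus.LefschetzGenerationKum4`, L1 of rung H3), registered
line `Cruxes/LefschetzGenerationKum4/Lines/laneV.lean` (v6: two stubs, `stub_LefschetzGenerationHilb5 : LefschetzGenerationHilbW 5`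
and the print bundle `stub_print`).  With item stmt-Ventures-20306 CLOSED by `Summit.Ventures.HodgeKum4.lefschetzGenerationHilb5_holds`
(module `…KummerFixedLocusLefschetzGenerationHilb5`, `lefschetzGenerationHilbW_all 5`), the line's first stub is a THEOREM; this
file is the line's §1–§2 (seam statements S1–S3, the lane-(V) output at `K⁴(A)`, the feeders) moved VERBATIM from the Lines file
into the compiled tree, plus the conditional closer

  `lefschetzGenerationKum4_of_print : LiQinWang2002W_… → Beauville1983_irreducibleSymplectic_… → LooijengaLuntsVerbitsky_… →
     HassettTschinkel2013_autZero_… → Fogarty1968_… → Beauville1983_kummerCover_galois → Verbitsky1996_… →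
     BNWS2011_autFixingH2H3_generalizedKummer → …Theses.KummerFixedLocus.LefschetzGenerationKum4`

— L1 holds CONDITIONALLY on exactly the eight refereed print facts of the registered bundle, nothing else (MODEL_X, the frame
complement and `KummerTranslationFrameExists` are not used).  HONEST FRAMING: this does NOT close item 19134 as typed (its
signature is unconditional and it is a binder of `closes`); it records «L1 proved modulo print» as a kernel theorem.  Nothing here
asserts HC_Kum4Type or HC.
-/
noncomputable section

open CategoryTheory MonoidalCategory CartesianMonoidalCategory TensorProduct
open Literature.AlgebraicTopology.SingularHomology
open Literature.AlgebraicGeometry Literature.AlgebraicGeometry.Hyperkaehler Literature.AlgebraicGeometry.HilbertScheme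
open Literature.AlgebraicGeometry.HodgeTheory (complexBetti)

namespace Summit.Ventures.HodgeKum4.LaneV

open scoped MonObj
open Literature.AlgebraicGeometry.HodgeTheory
open Literature.AlgebraicGeometry.Motives (AbelianVariety)

/-! ### §1 The seams S1–S3 (statements) and the lane-(V) output at `K⁴(A)` -/

/-- **SEAM S1 (instance seam).**  Every generalized Kummer variety `K` of an abelian surface `A` — by definition a
Kummer fibre of SOME Hilbert-scheme model `(H', Ξ')` of `n + 1` points — is a Kummer fibre of the `(n+1)`-st member
`H.obj (n + 1)` of some FULL choice `H : HilbertSchemesOfPoints A.X` of Hilbert schemes of points of `A` (the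
carrier of the lane-(V) Fock space).  Discharged below (`kummerFibreOfInstance_of_fogarty`) from the Grothendieck–Fogarty existence fact
`Fogarty1968_hilbertScheme_surface` (REFEREED, `HilbertSchemeOfPointsExists.lean`, p514830) by overriding one member of a
full choice by `(H', Ξ')` (`IsGeneralizedKummerVarietyOf.exists_hilbertSchemesOfPoints`, kernel). -/
def KummerFibreOfInstance : Prop :=
  ∀ ⦃n : ℕ⦄ ⦃A : AbelianVariety ℂ⦄ ⦃K : Motives.SchemeOver ℂ⦄, A.dim = 2 →
    IsGeneralizedKummerVarietyOf n A K →
      ∃ (H : HilbertSchemesOfPoints A.X) (𝒜 : Motives.Jacobian (H.obj (n + 1)))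
        (x₀ : 𝟙_ (Motives.SchemeOver ℂ) ⟶ H.obj (n + 1)) (j : K ⟶ H.obj (n + 1)),
        IsPullback j (toUnit K) (lift (𝟙 (H.obj (n + 1))) (toUnit (H.obj (n + 1)) ≫ x₀) ≫ 𝒜.diff)
          (1 : 𝟙_ (Motives.SchemeOver ℂ) ⟶ 𝒜.J.X)

/-- **SEAM S2 (even Casimir tensor).**  The Poincaré pairing of a smooth projective surface has a Casimir tensor
`C = Σᵢ eᵢ ⊗ εᵢ` lying in the EVEN part of `H* ⊗ H*` (kernel from Poincaré duality: the pairing is perfect on the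
finite-dimensional `H*(S(ℂ); ℂ)` and pairs `Hⁱ` with `H⁴⁻ⁱ`, so the Künneth class of the diagonal has only
components of bidegree `(i, 4 - i)`, total parity even).  PROVED below (`poincareEvenCasimirExists_holds`) from the
Literature theorem `exists_isCasimir_mem_evenTensorSpan` (`PoincareCasimirElement.lean`, p513175). -/
def PoincareEvenCasimirExists : Prop :=
  ∀ ⦃S : Motives.SchemeOver ℂ⦄ (hS : Motives.IsSmoothProjective 2 S),
    ∃ C : totalCohomology ℂ (Motives.ComplexPoints S) ⊗[ℂ] totalCohomology ℂ (Motives.ComplexPoints S),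
      C ∈ evenTensorSpan ℂ (coeffFamily S) ∧ IsCasimir ℂ (poincarePairing hS) C

/-- **SEAM S3 (a Lefschetz class on the Kummer fibre coming from the surface).**  For a polarization class `α` of
the abelian surface `A` and a Kummer fibre `j : K ⟶ A^[n+1]` (`n ≥ 1`, `K` smooth projective of dimension `2n`), the
class `θ*(D_α)` — `D_α = G₀(α, n+1) = 𝔊.divisorClass (n+1) α` — has a dual Lefschetz operator on `H*(K(ℂ); ℂ)`.
Source: Beauville 1983 §7 Prop. 8 (`H²(Kⁿ(A)) ⊃ H²(A)` with `q` restricting to the intersection form, so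
`q(θ*D_α) = α² > 0`) + Looijenga–Lunts 1997 (4.5)–(4.7) / Verbitsky (for hyper-Kähler manifolds a class with
`q ≠ 0` has the Lefschetz property).  PROVED below modulo print (`kummerDivisorClassLefschetz_of_print`), by an
INSTANCE-FREE route that never identifies `𝔊.divisorClass` with a geometric class: D3 makes `D_α` Lefschetz on
`A^[n+1]` for every `𝔊`, and `Theorems.KummerFixedLocusKummerDivisorClassLefschetz.hasDualLefschetz_map_kummerFibre`
transfers the Lefschetz property of ANY class along `θ` (top power, Beauville's cover `Θ`, Künneth, the
Verbitsky–Looijenga–Lunts–Fujiki criterion `Verbitsky1996_hasDualLefschetz_of_topPower_ne_zero`). -/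
def KummerDivisorClassLefschetz : Prop :=
  ∀ ⦃n : ℕ⦄ ⦃A : AbelianVariety ℂ⦄ ⦃K : Motives.SchemeOver ℂ⦄ (hA : A.dim = 2), 1 ≤ n →
    ∀ (hS : Motives.IsSmoothProjective 2 A.X) (H : HilbertSchemesOfPoints A.X) (𝔊 : ChernCharacterOperators hS H)
      (𝒜 : Motives.Jacobian (H.obj (n + 1))) (x₀ : 𝟙_ (Motives.SchemeOver ℂ) ⟶ H.obj (n + 1))
      (j : K ⟶ H.obj (n + 1)),
      IsPullback j (toUnit K) (lift (𝟙 (H.obj (n + 1))) (toUnit (H.obj (n + 1)) ≫ x₀) ≫ 𝒜.diff)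
        (1 : 𝟙_ (Motives.SchemeOver ℂ) ⟶ 𝒜.J.X) →
      Motives.IsSmoothProjective (2 * n) K →
      ∀ (α : complexBetti A.X 2), IsPolarizationClass 2 A.X α →
        HasDualLefschetz (2 * n) (complexBetti.map j 2 (𝔊.divisorClass (n + 1) α))

/-- **L1 at every ALGEBRAIC generalized Kummer eightfold** (the lane-(V) output before the `Kum⁴`-type transport;
literally the hypothesis `hKum` of T₄'s consumer `invariantClasses_le_opCupSpan_of_kummer` at `n = 4`, `N = 8`,
`D = {0, 2, 3}`): for every abelian surface `A`, every generalized Kummer variety `K = K⁴(A)` (smooth projective of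
dimension `8`) and every `sl(2)`-triple `(L_ℓ, h, Λ)` on `H*(K(ℂ); ℂ)`: `H*(K)^{Γ(K)} ⊆ ⟨H⁰, H², H³⟩_{(Λ, ∪)}`. -/
def LefschetzGenerationKummer4Alg : Prop :=
  ∀ ⦃A : AbelianVariety ℂ⦄ ⦃K : Motives.SchemeOver ℂ⦄, A.dim = 2 → IsGeneralizedKummerVarietyOf 4 A K →
    Motives.IsSmoothProjective (2 * 4) K →
    ∀ (ℓ : complexBetti K 2) (Λ : Module.End ℂ (totalCohomology ℂ (Motives.ComplexPoints K))),
      IsDualLefschetz 8 ℓ Λ → LefschetzGenerationKumAt K Λ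

/-! ### §2 Helper lemmas and the kernel feeder (proved; hypotheses explicit) -/

/-- `b₁ = 0` for a smooth projective generalized Kummer variety (`n ≥ 1`): it is irreducible symplectic (Beauville),
hence simply connected. -/
theorem complexBetti_one_eq_zero_of_kummer (hBe : Beauville1983_irreducibleSymplectic_of_kummerType) {n : ℕ}
    (hn : 1 ≤ n) {A : AbelianVariety ℂ} {K : Motives.SchemeOver ℂ} (hA : A.dim = 2)
    (hK : IsGeneralizedKummerVarietyOf n A K) (hKs : Motives.IsSmoothProjective (2 * n) K)
    (x : complexBetti K 1) : x = 0 := by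
  have hI := Beauville1983_irreducibleSymplectic_of_kummerType.generalizedKummer hBe hn hA hK hKs
  haveI : SimplyConnectedSpace (Motives.ComplexPoints K) := hI.2.1
  haveI := ModuleCat.subsingleton_of_isZero
    (isZero_singularCohomology_one_of_simplyConnectedSpace (X := Motives.ComplexPoints K) ℂ)
  exact Subsingleton.elim x 0

/-- **`h ≠ 0` on every member of a chosen family of Hilbert schemes** (the side condition `hh` of D3 /
`lefschetzGenerationKumAt_of_hilb`): `A^[m]` is smooth projective, so `dim H⁰(A^[m](ℂ); ℂ) = 1`
(`Surfaces.finrank_complexBetti_zero`) and `h` acts on `H⁰ ≠ 0` by the nonzero scalar `0 - 2m` … precisely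
`Hyperkaehler.degreeOperator_ne_zero_of_ne_zero` with `k = 0 ≠ N = 2m` (`m ≥ 1`). -/
theorem degreeOperator_hilbObj_ne_zero {S : Motives.SchemeOver ℂ} (H : HilbertSchemesOfPoints S) {m : ℕ}
    (hm : 1 ≤ m) : degreeOperator ℂ (Motives.ComplexPoints (H.obj m)) (2 * m) ≠ 0 := by
  haveI : Nontrivial (complexBetti (H.obj m) 0) := Module.nontrivial_of_finrank_pos (R := ℂ)
    (by rw [Literature.AlgebraicGeometry.Surfaces.finrank_complexBetti_zero (H.smooth m)]; exact Nat.one_pos)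
  obtain ⟨x, hx⟩ := exists_ne (0 : complexBetti (H.obj m) 0)
  exact degreeOperator_ne_zero_of_ne_zero (k := 0) (N := 2 * m) (by omega) hx

/-- **THE LANE-(V) OUTPUT: L1 at every algebraic `K⁴(A)`** from L1-Hilb(5) in `W`-form (ONE zero-mode instance),
V0, the bridge, the three small seams S1–S3 and the named print facts (Li–Qin–Wang's Chern character operators as
`W`-algebra zero-modes on an abelian surface; Beauville's `Kⁿ(A)` is IHS; the LLV structure of `Kumⁿ`-type); D3 is
the Literature theorem used inside `lefschetzGenerationKumAt_kummer_of_hilbW`.  CONDITIONAL on all binders; nothing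
is proved outright. -/
theorem lefschetzGenerationKummer4Alg_of_laneV
    (hLQWW : LiQinWang2002W_chernCharacter_zeroModes_abelianSurface)
    (hBe : Beauville1983_irreducibleSymplectic_of_kummerType)
    (hF : LooijengaLuntsVerbitsky_llvStructure_kumType)
    (hL5 : LefschetzGenerationHilbW 5) (hV0 : HilbertKummerTransfer) (hB : KummerRangeEqInvariants)
    (hS1 : KummerFibreOfInstance) (hS2 : PoincareEvenCasimirExists) (hS3 : KummerDivisorClassLefschetz) :
    LefschetzGenerationKummer4Alg := by
  intro A K hA hK hKs ℓ Λ hΛ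
  -- the instance carrying the Fock space, with `K` as a Kummer fibre of `A^[5] = H.obj 5`
  obtain ⟨H, 𝒜, x₀, j, hsq⟩ := hS1 hA hK
  have hS : Motives.IsSmoothProjective 2 A.X := hA ▸ AbelianVariety.isSmoothProjective_holds
  obtain ⟨𝔊, -, h𝔊⟩ := hLQWW A hA hS H
  obtain ⟨C, hCg, hC⟩ := hS2 hS
  -- a polarization class `α` of `A`, Lefschetz on `A`, with `θ*(D_α)` Lefschetz on `K`
  obtain ⟨α, -, -, hα⟩ := exists_isPolarizationClass_mem_algebraicClasses hS
  obtain ⟨Λ_A, hΛA⟩ := IsPolarizationClass.hasDualLefschetz (n := 2) two_pos hS hα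
  obtain ⟨Λ₀, hΛ₀⟩ := hS3 hA (n := 4) (by norm_num) hS H 𝔊 𝒜 x₀ j hsq hKs α hα
  -- `b₁(K) = 0`, `h_{A^[5]} ≠ 0`, `K` of `Kum⁴`-type; then the v2 glue (all triples at once)
  have h1 : ∀ x : complexBetti K 1, x = 0 :=
    complexBetti_one_eq_zero_of_kummer hBe (n := 4) (by norm_num) hA hK hKs
  have hh := degreeOperator_hilbObj_ne_zero H (m := 4 + 1) (by norm_num)
  obtain ⟨M⟩ := nonempty_hodgeModel_holds hKs
  exact lefschetzGenerationKumAt_kummer_of_hilbW hV0 hB hF (n := 4) hL5 hA (by norm_num) hS H 𝔊 h𝔊 hCg hC hh 𝒜 x₀ j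
    hsq hKs (IsOfGeneralizedKummerType.of_hodgeModel hA hK hKs M) h1 hΛA hΛ₀ ℓ Λ hΛ

/-- **THE FEEDER `lefschetzGenerationKum4_of_laneV`** = the conditional proof of the rev-20 SPLIT GLUE
`LefschetzGenerationHilbW 5 → HilbertKummerTransfer → KummerRangeEqInvariants → LefschetzGenerationKum4`: the chain
`L1-HilbW(5) → V0 → bridge → (D3 thm, S1–S3, LQW-W, Beauville, LLV) → L1 at every K⁴(A) → (T₄ fact + its proved
consumer) → LefschetzGenerationKum4`.  CONDITIONAL on every binder; MODEL_X (item 19267), the frame complement and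
`KummerTranslationFrameExists` are NOT used. -/
theorem lefschetzGenerationKum4_of_laneV
    (hT4 : HassettTschinkel2013_autZero_cohomologyTransport_kumType)
    (hLQWW : LiQinWang2002W_chernCharacter_zeroModes_abelianSurface)
    (hBe : Beauville1983_irreducibleSymplectic_of_kummerType)
    (hF : LooijengaLuntsVerbitsky_llvStructure_kumType)
    (hS1 : KummerFibreOfInstance) (hS2 : PoincareEvenCasimirExists) (hS3 : KummerDivisorClassLefschetz)
    (hL5 : LefschetzGenerationHilbW 5) (hV0 : HilbertKummerTransfer) (hB : KummerRangeEqInvariants) :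
    Summit.Ventures.HodgeKum4.LefschetzGenerationKum4 :=
  fun _X hX hXK ℓ Λ hΛ ↦
    HassettTschinkel2013_autZero_cohomologyTransport_kumType.invariantClasses_le_opCupSpan_of_kummer hT4 (n := 4)
      (lefschetzGenerationKummer4Alg_of_laneV hLQWW hBe hF hL5 hV0 hB hS1 hS2 hS3) hX hXK ℓ Λ hΛ
/-! ### §3 Seams S1–S3 discharged (S2 outright, S1/S3 modulo print) -/

/-- **Seam S1, PROVED modulo print** (instance bookkeeping): from the Grothendieck–Fogarty existence fact, every
generalized Kummer variety of an abelian surface is a Kummer fibre of a member of a FULL choice of Hilbert schemes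
(v0typer g2's glue; `hS` from `A.dim = 2`). -/
theorem kummerFibreOfInstance_of_fogarty (hGF : Fogarty1968_hilbertScheme_surface) : KummerFibreOfInstance :=
  fun _n _A _K hA hK ↦ hK.exists_hilbertSchemesOfPoints hGF (hA ▸ AbelianVariety.isSmoothProjective_holds)

/-- **Seam S2, PROVED** (even Casimir tensor of the Poincaré pairing of a smooth projective surface). -/
theorem poincareEvenCasimirExists_holds : PoincareEvenCasimirExists :=
  fun _S hS ↦
    let ⟨C, hCg, hC⟩ := exists_isCasimir_mem_evenTensorSpan hS
    ⟨C, hCg, hC⟩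

/-- **Seam S3, PROVED modulo print** (`θ*D_α` has a dual Lefschetz operator on the Kummer fibre): D3 (every
instance `𝔊`) composed with the instance-free Lefschetz transfer along Beauville's cover (`hasDualLefschetz_map_divisorClass`,
`Theorems/KummerFixedLocusKummerDivisorClassLefschetz.lean`, p521059); print inputs = Beauville's IHS theorem, the
Galois-cover fact (F6) and the Verbitsky–Looijenga–Lunts–Fujiki criterion, all from the print stub. -/
theorem kummerDivisorClassLefschetz_of_print (hBe : Beauville1983_irreducibleSymplectic_of_kummerType)
    (hGal : Beauville1983_kummerCover_galois) (hV : Verbitsky1996_hasDualLefschetz_of_topPower_ne_zero) :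
    KummerDivisorClassLefschetz :=
  fun _ _ _ hA hn hS H 𝔊 𝒜 x₀ j hsq hKs α hα ↦ hasDualLefschetz_map_divisorClass hBe hGal hV hA hn hS H 𝔊 𝒜 x₀ j hsq hKs α hα

/-! ### §4 L1 modulo print -/

/-- **L1 `LefschetzGenerationKum4` from the eight refereed print facts of the registered bundle, in the bundle's order**
(Li–Qin–Wang zero-modes, Beauville IHS, LLV structure, Hassett–Tschinkel transport, Grothendieck–Fogarty, Beauville's Galois
cover, Verbitsky's Lefschetz criterion, BNWS): the line's composition with `stub_LefschetzGenerationHilb5` replaced by the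
THEOREM `lefschetzGenerationHilbW_all 5` and V0 / the bridge by their landed `_of_print` theorems. -/
theorem lefschetzGenerationKum4_of_print (hLQWW : LiQinWang2002W_chernCharacter_zeroModes_abelianSurface)
    (hBe : Beauville1983_irreducibleSymplectic_of_kummerType) (hF : LooijengaLuntsVerbitsky_llvStructure_kumType)
    (hT4 : HassettTschinkel2013_autZero_cohomologyTransport_kumType) (hGF : Fogarty1968_hilbertScheme_surface)
    (hGal : Beauville1983_kummerCover_galois) (hV : Verbitsky1996_hasDualLefschetz_of_topPower_ne_zero)
    (hBNWS : BNWS2011_autFixingH2H3_generalizedKummer) :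
    Summit.Ventures.HodgeKum4.Theses.KummerFixedLocus.LefschetzGenerationKum4 :=
  lefschetzGenerationKum4_of_laneV hT4 hLQWW hBe hF (kummerFibreOfInstance_of_fogarty hGF) poincareEvenCasimirExists_holds
    (kummerDivisorClassLefschetz_of_print hBe hGal hV) (lefschetzGenerationHilbW_all 5)
    (Summit.Ventures.HodgeKum4.HilbertKummer.hilbertKummerTransfer_of_print' hBe hGal)
    (kummerRangeEqInvariants_of_print hGal hBNWS)

/-- The same with the print bundle as ONE conjunction (the registered `stub_print` shape). -/
theorem lefschetzGenerationKum4_of_printBundle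
    (hP : LiQinWang2002W_chernCharacter_zeroModes_abelianSurface ∧ Beauville1983_irreducibleSymplectic_of_kummerType ∧
      LooijengaLuntsVerbitsky_llvStructure_kumType ∧ HassettTschinkel2013_autZero_cohomologyTransport_kumType ∧
        Fogarty1968_hilbertScheme_surface ∧ Beauville1983_kummerCover_galois ∧
          Verbitsky1996_hasDualLefschetz_of_topPower_ne_zero ∧ BNWS2011_autFixingH2H3_generalizedKummer) :
    Summit.Ventures.HodgeKum4.Theses.KummerFixedLocus.LefschetzGenerationKum4 :=
  lefschetzGenerationKum4_of_print hP.1 hP.2.1 hP.2.2.1 hP.2.2.2.1 hP.2.2.2.2.1 hP.2.2.2.2.2.1 hP.2.2.2.2.2.2.1 hP.2.2.2.2.2.2.2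


/-! ### §5 ALL `n`: L1 for every `Kumⁿ` (n ≥ 2) modulo the same eight print facts -/

/-- L1 at every triple of every smooth projective generalized Kummer variety `Kⁿ(A)` (all `n`). -/
def LefschetzGenerationKummerAlg (n : ℕ) : Prop :=
  ∀ ⦃A : AbelianVariety ℂ⦄ ⦃K : Motives.SchemeOver ℂ⦄, A.dim = 2 → IsGeneralizedKummerVarietyOf n A K →
    Motives.IsSmoothProjective (2 * n) K →
    ∀ (ℓ : complexBetti K 2) (Λ : Module.End ℂ (totalCohomology ℂ (Motives.ComplexPoints K))),
      IsDualLefschetz (2 * n) ℓ Λ → LefschetzGenerationKumAt K Λ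

/-- **ALL-n lane-(V) output at `Kⁿ(A)`** (plan g19 AllNFeeder 80990d5b6db731d7, literals `4, 5, 8` ↦ `n, n+1, 2n`):
L1-HilbW(n+1) ∧ V0 ∧ bridge ∧ S1–S3 ∧ LQW-W ∧ Beauville ∧ LLV ⟹ L1 at every triple of every `Kⁿ(A)`, `n ≥ 2`. -/
theorem lefschetzGenerationKummerAlg_of_laneV
    (hLQWW : LiQinWang2002W_chernCharacter_zeroModes_abelianSurface)
    (hBe : Beauville1983_irreducibleSymplectic_of_kummerType)
    (hF : LooijengaLuntsVerbitsky_llvStructure_kumType)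
    {n : ℕ} (hn : 2 ≤ n) (hL : LefschetzGenerationHilbW (n + 1)) (hV0 : HilbertKummerTransfer)
    (hB : KummerRangeEqInvariants)
    (hS1 : KummerFibreOfInstance) (hS2 : PoincareEvenCasimirExists) (hS3 : KummerDivisorClassLefschetz) :
    LefschetzGenerationKummerAlg n := by
  intro A K hA hK hKs ℓ Λ hΛ
  obtain ⟨H, 𝒜, x₀, j, hsq⟩ := hS1 hA hK
  have hS : Motives.IsSmoothProjective 2 A.X := hA ▸ AbelianVariety.isSmoothProjective_holds
  obtain ⟨𝔊, -, h𝔊⟩ := hLQWW A hA hS H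
  obtain ⟨C, hCg, hC⟩ := hS2 hS
  obtain ⟨α, -, -, hα⟩ := exists_isPolarizationClass_mem_algebraicClasses hS
  obtain ⟨Λ_A, hΛA⟩ := IsPolarizationClass.hasDualLefschetz (n := 2) two_pos hS hα
  obtain ⟨Λ₀, hΛ₀⟩ := hS3 hA (n := n) (by omega) hS H 𝔊 𝒜 x₀ j hsq hKs α hα
  have h1 : ∀ x : complexBetti K 1, x = 0 :=
    complexBetti_one_eq_zero_of_kummer hBe (n := n) (by omega) hA hK hKs
  have hh := degreeOperator_hilbObj_ne_zero H (m := n + 1) (by omega)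
  obtain ⟨M⟩ := nonempty_hodgeModel_holds hKs
  exact lefschetzGenerationKumAt_kummer_of_hilbW hV0 hB hF (n := n) hL hA hn hS H 𝔊 h𝔊 hCg hC hh 𝒜 x₀ j
    hsq hKs (IsOfGeneralizedKummerType.of_hodgeModel hA hK hKs M) h1 hΛA hΛ₀ ℓ Λ hΛ

/-- **The all-`n` feeder**: `LefschetzGenerationHilbW (n+1) → … → LefschetzGenerationKum n` for every `n ≥ 2`. -/
theorem lefschetzGenerationKum_of_laneV
    (hT4 : HassettTschinkel2013_autZero_cohomologyTransport_kumType)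
    (hLQWW : LiQinWang2002W_chernCharacter_zeroModes_abelianSurface)
    (hBe : Beauville1983_irreducibleSymplectic_of_kummerType)
    (hF : LooijengaLuntsVerbitsky_llvStructure_kumType)
    (hS1 : KummerFibreOfInstance) (hS2 : PoincareEvenCasimirExists) (hS3 : KummerDivisorClassLefschetz)
    {n : ℕ} (hn : 2 ≤ n) (hL : LefschetzGenerationHilbW (n + 1)) (hV0 : HilbertKummerTransfer)
    (hB : KummerRangeEqInvariants) :
    LefschetzGenerationKum n :=
  fun _X hX hXK ℓ Λ hΛ ↦
    HassettTschinkel2013_autZero_cohomologyTransport_kumType.invariantClasses_le_opCupSpan_of_kummer hT4 (n := n)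
      (lefschetzGenerationKummerAlg_of_laneV hLQWW hBe hF hn hL hV0 hB hS1 hS2 hS3) hX hXK ℓ Λ hΛ

/-- **K1_unif reduction (OUTLOOK §12 (2), checked)**: all-`n` Hilbert side ⟹ L1 for every `Kumⁿ`, `n ≥ 2`,
modulo the same named inputs as at `n = 4` (V0 and the bridge are now tree theorems modulo print). -/
theorem lefschetzGenerationKum_all_of_hilbW_all
    (hT4 : HassettTschinkel2013_autZero_cohomologyTransport_kumType)
    (hLQWW : LiQinWang2002W_chernCharacter_zeroModes_abelianSurface)
    (hBe : Beauville1983_irreducibleSymplectic_of_kummerType)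
    (hF : LooijengaLuntsVerbitsky_llvStructure_kumType)
    (hS1 : KummerFibreOfInstance) (hS2 : PoincareEvenCasimirExists) (hS3 : KummerDivisorClassLefschetz)
    (hV0 : HilbertKummerTransfer) (hB : KummerRangeEqInvariants)
    (hL : ∀ m, LefschetzGenerationHilbW m) : ∀ n, 2 ≤ n → LefschetzGenerationKum n :=
  fun n hn ↦ lefschetzGenerationKum_of_laneV hT4 hLQWW hBe hF hS1 hS2 hS3 hn (hL (n + 1)) hV0 hB

/-- **K1_unif MODULO PRINT: L1 for EVERY `Kumⁿ`, `n ≥ 2`, from the eight refereed print facts of the registered bundle** —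
the all-`n` Hilbert statement is the THEOREM `lefschetzGenerationHilbW_all`; V0 ∕ bridge ∕ S1–S3 are discharged by the tree
theorems modulo their print antecedents. -/
theorem lefschetzGenerationKum_all_of_print
    (hLQWW : LiQinWang2002W_chernCharacter_zeroModes_abelianSurface)
    (hBe : Beauville1983_irreducibleSymplectic_of_kummerType)
    (hF : LooijengaLuntsVerbitsky_llvStructure_kumType)
    (hT4 : HassettTschinkel2013_autZero_cohomologyTransport_kumType)
    (hGF : Fogarty1968_hilbertScheme_surface) (hG : Beauville1983_kummerCover_galois)
    (hVe : Verbitsky1996_hasDualLefschetz_of_topPower_ne_zero) (hBN : BNWS2011_autFixingH2H3_generalizedKummer) :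
    ∀ n, 2 ≤ n → LefschetzGenerationKum n :=
  lefschetzGenerationKum_all_of_hilbW_all hT4 hLQWW hBe hF
    (fun _n _A _K hA hK ↦ hK.exists_hilbertSchemesOfPoints hGF (hA ▸ AbelianVariety.isSmoothProjective_holds))
    (fun _S hS ↦ let ⟨C, hCg, hC⟩ := exists_isCasimir_mem_evenTensorSpan hS; ⟨C, hCg, hC⟩)
    (fun _n _A _K hA hn hS H 𝔊 𝒜 x₀ j hsq hKs α hα ↦
      hasDualLefschetz_map_divisorClass hBe hG hVe hA hn hS H 𝔊 𝒜 x₀ j hsq hKs α hα)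
    (Summit.Ventures.HodgeKum4.HilbertKummer.hilbertKummerTransfer_of_print' hBe hG)
    (Summit.Ventures.HodgeKum4.kummerRangeEqInvariants_of_print hG hBN) lefschetzGenerationHilbW_all

end Summit.Ventures.HodgeKum4.LaneV

end
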